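import Summits.QuantumFields.YangMills.Theorems.BalabanUVNodesN15KingModelPotentialDressedStepGradRun
import Summits.QuantumFields.YangMills.Theorems.BalabanUVNodesN15KingModelPotentialDressedOperator

/-!
# N15 (NE2⁺), King-model rung, part 19b: the `p = 1` SITE entry for the DRESSED minimiser with the potential LIVE, BY NAME

Cell `pub-ymgap-dag-n15-d` (R134 acceleration DAG, node N15 = NE2, strategy s3 KING-MODEL RUNG), part 19b.  Part 15
(`…PotentialDressedSite`) inhabited the [B9] (3.133)-shaped `p = 0` sup entry of the DRESSED minimiser's η-difference (`kingHSiteV`,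
`NE2PlusSite` by name on the size-and-coherence family `kingInstanceSC`); part 19a (`…PotentialDressedStepGradRun`) proved King's
Prop. 3.8 (3.71) LINE 2 for the dressed minimiser along the run (`dkingHPot_step_kingU`, rate `(L^{−γ∕2})^k + ν₀s^k`, `0 ≤ γ < 1`).
This file is the `p = 1` companion of parts 15 ∕ 16 — n15-e's `dkingHSite` ∕ `ne2PlusSite_dkingH` (`…KingModelMinimizerNode`, UNDRESSED,
background-blind) with the potential sort live (imports 19a + part 16 `…PotentialDressedOperator`, which carries part 15):

* §1 `dkingHPotStep` (the paired η-difference of the unit-lattice GRADIENT of the dressed minimiser at a fine point) and the dressed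
  derivative sup entry `dkingHSiteV`: `(y, b) ↦ sup_{B(x′) = y} Σ_μ |∂^{η′}_μℋ_{k+1,v}(x′, b) − ∂^η_μℋ_{k,v}(x, b)|` (`x` under `x′`) on the
  part-8c family `kingInstanceV`; its bound `≤ C·e^{−δ|y−b|}·(L^{−γ∕2})^k` inside the window (`dkingHSiteV_le`, from part 19a);
  `kingInstanceV_rateFactor_rpow` (the coarse geometry's rate factor at a general exponent);
* §2 `etaRateIneqSite_dkingHV`: on the part-8c family, for every index, every `α₀` in the window and every tower `v` which is (3.35)- AND
  (3.36)-regular, `EtaRateIneqSite d′ p (dkingHSiteV i) C δ (γ∕2) v` (every `(d′, p)`: unit site lengths); `ne2ZeroSite_dkingHV`;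
* §3 on part 15's size-and-coherence sort `potBgSC`: `dkingHSiteSC` and ★★ `ne2PlusSite_dkingHSC : NE2PlusSite d′ p c₃₅ (kingInstanceSC L s)
  (dkingHSiteSC L a m² s)` BY NAME (`0 < γ < 1`), `ne2ZeroSite_dkingHSC`, and the conjunction `n15_dressedSiteGradUnit_kingSC` (BOTH (3.133)
  sup entries `p = 0, 1` AND the unit layer, background-dependent, on ONE family with the potential live);
* §4 the node's K4 face with the GRADIENT entry in the site slot: `kingCarriersSCGrad : NE2Carriers` (part 16's `kingCarriersSC` with
  `Ksite := dkingHSiteSC`) and ★★ `n15At_kingModelSCGrad : N15At (kingCarriersSCGrad d L a m² s c₃₅ p)` (operator layer part 16, site layer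
  THIS file at `γ = 1∕2`, unit layer part 15 ∕ 10d), `_dim4`, index ∕ window non-vacuity.

WHY TWO SORTS: exactly as in part 15 (an η-rate for a background-DEPENDENT kernel reads two members of the tower, so it needs the coherence
letter; `NE2PlusSite` reads the (3.35) slot only) — the slot assignment is OUR reading.

HONEST SCOPE.  King's A = 0 scalar model on the King-admissible tori `Π ℤ∕(2L^{e+1})`, odd `L ≥ 3`, `a, m² > 0`; scalar potentials (NOT
gauge fields; nothing here is Bałaban's `H_k(U)` of [B9] §D); sup entries with the [B9] exponent `p` free because every site has unit length;
rate exponent `γ∕2`, `γ < 1` strict (the gradient loses King's `(L^kη)^{−γ}`, n18 `douterRate_le_unif`); count-neutral (`--supports`), not a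
discharge of N15, nothing in `YMDAG.*` touched.  WHAT THE CURVED CASE ADDS: the same two lines for Bałaban's covariant `H_k(U)` over
`Reg335` — print gives (3.133) and analyticity in `U`, never an η-difference (n15-e's curved edition types the gap).

References: [B9] = Bałaban, Commun. Math. Phys. 102 (1985) 385–462, (3.35)–(3.36) p.396, (3.133) p.422, Thm 3.14 pp.426–427, Thm 3.15
p.432 (bib key `Balaban1985BackgroundPropagators`); C. King, Commun. Math. Phys. 102 (1986) 649–677, Prop. 3.8 (3.71) p.664 (second
line), Lemma 4.5 (4.38) p.674 (bib key `King1986`).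
-/

noncomputable section
open scoped BigOperators
open Finset

namespace Summit.QuantumFields.YangMills.BalabanUVNodes.N15.KingModel

open Literature.MathematicalPhysics.QuantumFieldTheory.Balaban1983to89 hiding blockOf
open Literature.MathematicalPhysics.QuantumFieldTheory.Balaban1983to89.T4EtaRate (PairedInstance EtaPairing NE2PlusUnit NE2PlusSite
  EtaRateIneqSite rateFactor)
open Literature.MathematicalPhysics.QuantumFieldTheory.Balaban1983to89.T4EtaRateSiteOfRatePair (NE2ZeroSite)
open Literature.MathematicalPhysics.QuantumFieldTheory.Balaban1983to89.B5Prop11Plancherel (Tor fine unitVec)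
open Literature.MathematicalPhysics.QuantumFieldTheory.King1986.Torus (blockOf tdistT tdistT_nonneg)
open Summit.QuantumFields.YangMills.BalabanUVNodes.N15KingModelRung (kingBlockFibre mem_kingBlockFibre kingBlockFibre_nonempty)
open Summit.QuantumFields.YangMills.BalabanUVNodes.N15KingModelRung.Curved (underPtN blockOf_underPtN)
open Summit.QuantumFields.YangMills.BalabanUVNodes.N15.OperatorReadout (opGeo opGeo_len rateFactor_opGeo)
open YMDAG.UVSplit (NE2Carriers N15At)
open Real

variable {d : ℕ}

/-! ## §1 The dressed derivative sup entry and its bound inside the window -/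

section Kernel

variable (L : ℕ) [NeZero L]

/-- THE PAIRED η-DIFFERENCE OF THE GRADIENT OF THE DRESSED MINIMISER at a fine point `x′` of the finer run (volume exponent `e`, `k` coarse
scales, tower `v`, source block `b`, direction `μ`): `N′·(ℋ_{k+1,v}(x′+e_μ, b) − ℋ_{k+1,v}(x′, b)) − N·(ℋ_{k,v}(x+e_μ, b) − ℋ_{k,v}(x, b))`,
`x` under `x′`, `N = L^k`, `N′ = L·L^k` (the object of part 19a's `dkingHPot_step_kingU`).
[cite: King1986, Prop. 3.8 (3.71) p.664 (second line, object; A = 0 model dressed by a potential)] -/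
def dkingHPotStep (a m2 : ℝ) (e k : ℕ) (v : ∀ N : ℕ, Tor (fine N (kingU d L e)) → ℝ) (b : Tor (kingU d L e)) (μ : Fin (d + 1))
    (x' : Tor (fine (L ^ 1 * L ^ k) (kingU d L e))) : ℝ :=
  ((L ^ 1 * L ^ k : ℕ) : ℝ) *
      (kingHPot L (L ^ 1 * L ^ k) (kingU d L e) a m2 (k + 1) (v (L ^ 1 * L ^ k)) b (x' + unitVec (fine (L ^ 1 * L ^ k) (kingU d L e)) μ)
        - kingHPot L (L ^ 1 * L ^ k) (kingU d L e) a m2 (k + 1) (v (L ^ 1 * L ^ k)) b x')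
    - ((L ^ k : ℕ) : ℝ) *
      (kingHPot L (L ^ k) (kingU d L e) a m2 k (v (L ^ k)) b (underPtN L k 1 (kingU d L e) x' + unitVec (fine (L ^ k) (kingU d L e)) μ)
        - kingHPot L (L ^ k) (kingU d L e) a m2 k (v (L ^ k)) b (underPtN L k 1 (kingU d L e) x'))

/-- **THE DRESSED MINIMISER'S DERIVATIVE η-DIFFERENCE SUP ENTRY** at index `i = (e, k, n, Msz)` and potential tower `v`: at observation unit
site `y` and source unit site `b`, `sup_{x′ ∈ T_{η′}, B(x′) = y} Σ_μ |∂^{η′}_μℋ_{k+1,v}(x′, b) − ∂^η_μℋ_{k,v}(x, b)|` (`x` under `x′`) — the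
`p = 1` [B9] (3.133) sup entry of the one-step difference, BACKGROUND-DEPENDENT (n15-e's `dkingHSite` with the potential live).
[cite: Balaban1985BackgroundPropagators, (3.133) p.422 (sup-entry shape); King1986, Prop. 3.8 (3.71) p.664 (second line, object)] -/
def dkingHSiteV (a m2 s : ℝ) (i : KingPotIdx d) : B9.SiteKernel (kingInstanceV L s i).gc (kingInstanceV L s i).Bf :=
  ⟨fun v y b => (kingBlockFibre (L ^ 1 * L ^ i.k) (kingU d L i.e) y).sup' (kingBlockFibre_nonempty _ _ y) fun x' =>
      ∑ μ : Fin (d + 1), |dkingHPotStep L a m2 i.e i.k v b μ x'|⟩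

/-- The derivative sup entry is nonnegative. [folklore] -/
theorem dkingHSiteV_nonneg (a m2 s : ℝ) (i : KingPotIdx d) (v : ∀ N : ℕ, Tor (fine N (kingU d L i.e)) → ℝ) (y b : Tor (kingU d L i.e)) :
    0 ≤ (dkingHSiteV L a m2 s i).ker v y b := by
  obtain ⟨x', hx'⟩ := kingBlockFibre_nonempty (L ^ 1 * L ^ i.k) (kingU d L i.e) y
  exact (sum_nonneg fun μ _ => abs_nonneg _).trans
    (Finset.le_sup' (fun x' => ∑ μ : Fin (d + 1), |dkingHPotStep L a m2 i.e i.k v b μ x'|) hx')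

/-- **THE DRESSED DERIVATIVE SUP ENTRY INSIDE THE WINDOW** (odd `L ≥ 3`, `a, m² > 0`, `0 ≤ γ < 1`): there are `w̄, C, δ > 0` such that for
every coherence rate `0 ≤ s ≤ L^{−1∕2}`, every index, and every tower `v` of size `≤ w₀ ≤ w̄` with coherence defect `≤ ν₀s^k` (`0 ≤ ν₀ ≤ w̄`),
`sup_{B(x′)=y} Σ_μ |∂′ℋ_{k+1,v}(x′, b) − ∂ℋ_{k,v}(x, b)| ≤ C·e^{−δ|y−b|}·(L^{−γ∕2})^k` — part 19a's line-2 bound read on the block and summed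
over the `d + 1` directions (`s ≤ L^{−1∕2} ≤ L^{−γ∕2}`). [cite: King1986, Prop. 3.8 (3.71) p.664 (second line, A = 0 model)] -/
theorem dkingHSiteV_le (hLodd : Odd L) (hL : 2 ≤ L) {a m2 : ℝ} (ha : 0 < a) (hm : 0 < m2) {γ : ℝ} (hγ0 : 0 ≤ γ) (hγ1 : γ < 1) :
    ∃ wb C δ : ℝ, 0 < wb ∧ 0 < C ∧ 0 < δ ∧ ∀ (s : ℝ), 0 ≤ s → s ≤ (L : ℝ) ^ (-(1 / 2 : ℝ)) →
      ∀ (i : KingPotIdx d) (v : ∀ N : ℕ, Tor (fine N (kingU d L i.e)) → ℝ) (w₀ ν₀ : ℝ),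
      (∀ (N : ℕ) (x : Tor (fine N (kingU d L i.e))), |v N x| ≤ w₀) → w₀ ≤ wb → 0 ≤ ν₀ → ν₀ ≤ wb →
      (∀ (k : ℕ), 1 ≤ k → ∀ x' : Tor (fine (L ^ 1 * L ^ k) (kingU d L i.e)),
          |v (L ^ 1 * L ^ k) x' - v (L ^ k) (underPtN L k 1 (kingU d L i.e) x')| ≤ ν₀ * s ^ k) →
      ∀ y b : Tor (kingU d L i.e),
        (dkingHSiteV L a m2 s i).ker v y b ≤ C * Real.exp (-(δ * tdistT (kingU d L i.e) y b)) * (((L : ℝ) ^ (-(γ / 2))) ^ i.k) := by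
  obtain ⟨wb, c, δ, hwb, hc, hδ, H⟩ := dkingHPot_step_kingU (d := d) L hLodd hL ha hm hγ0 hγ1
  refine ⟨wb, ((d + 1 : ℕ) : ℝ) * (c * (1 + wb)), δ, hwb, by positivity, hδ,
    fun s hs0 hs1 i v w₀ ν₀ hv hw hν0 hν1 hcoh y b => ?_⟩
  have hL1 : (1 : ℝ) ≤ L := by exact_mod_cast (show 1 ≤ L by omega)
  set θ : ℝ := (L : ℝ) ^ (-(γ / 2)) with hθdef
  have hθ0 : 0 ≤ θ := Real.rpow_nonneg (Nat.cast_nonneg _) _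
  have hsθ : s ≤ θ := hs1.trans (Real.rpow_le_rpow_of_exponent_le hL1 (by linarith))
  have hsk : s ^ i.k ≤ θ ^ i.k := pow_le_pow_left₀ hs0 hsθ _
  have hE : 0 ≤ Real.exp (-(δ * tdistT (kingU d L i.e) y b)) := (Real.exp_pos _).le
  show (kingBlockFibre (L ^ 1 * L ^ i.k) (kingU d L i.e) y).sup' (kingBlockFibre_nonempty _ _ y) (fun x' =>
      ∑ μ : Fin (d + 1), |dkingHPotStep L a m2 i.e i.k v b μ x'|) ≤ _
  refine Finset.sup'_le _ _ fun x' hx' => ?_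
  have hblk : blockOf (L ^ 1 * L ^ i.k) (kingU d L i.e) x' = y := (mem_kingBlockFibre _ _ y x').1 hx'
  have h2 : θ ^ i.k + ν₀ * s ^ i.k ≤ (1 + wb) * θ ^ i.k := by
    have : ν₀ * s ^ i.k ≤ wb * θ ^ i.k := mul_le_mul hν1 hsk (pow_nonneg hs0 _) hwb.le
    linarith
  have hterm : ∀ μ : Fin (d + 1), |dkingHPotStep L a m2 i.e i.k v b μ x'|
      ≤ c * (1 + wb) * Real.exp (-(δ * tdistT (kingU d L i.e) y b)) * θ ^ i.k := fun μ => by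
    have h1 : |dkingHPotStep L a m2 i.e i.k v b μ x'| ≤ c * (θ ^ i.k + ν₀ * s ^ i.k)
        * Real.exp (-(δ * tdistT (kingU d L i.e) (blockOf (L ^ 1 * L ^ i.k) (kingU d L i.e) x') b)) :=
      H i.e v w₀ ν₀ s hv hw hν0 hs0 hs1 hcoh i.k i.one_le_k b μ x'
    rw [hblk] at h1
    calc |dkingHPotStep L a m2 i.e i.k v b μ x'|
        ≤ c * (θ ^ i.k + ν₀ * s ^ i.k) * Real.exp (-(δ * tdistT (kingU d L i.e) y b)) := h1
      _ ≤ c * ((1 + wb) * θ ^ i.k) * Real.exp (-(δ * tdistT (kingU d L i.e) y b)) :=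
          mul_le_mul_of_nonneg_right (mul_le_mul_of_nonneg_left h2 hc.le) hE
      _ = c * (1 + wb) * Real.exp (-(δ * tdistT (kingU d L i.e) y b)) * θ ^ i.k := by ring
  calc ∑ μ : Fin (d + 1), |dkingHPotStep L a m2 i.e i.k v b μ x'|
      ≤ ∑ _μ : Fin (d + 1), c * (1 + wb) * Real.exp (-(δ * tdistT (kingU d L i.e) y b)) * θ ^ i.k :=
        sum_le_sum fun μ _ => hterm μ
    _ = ((d + 1 : ℕ) : ℝ) * (c * (1 + wb)) * Real.exp (-(δ * tdistT (kingU d L i.e) y b)) * θ ^ i.k := by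
        rw [sum_const, card_univ, Fintype.card_fin, nsmul_eq_mul]
        ring

/-- The rate factor of the coarse geometry at a general exponent `t` is `(L^{−t})^k`. [folklore] -/
theorem kingInstanceV_rateFactor_rpow (hL : 2 ≤ L) (s t : ℝ) (i : KingPotIdx d) (y : Tor (kingU d L i.e)) :
    rateFactor (kingInstanceV (d := d) L s i).gc t y = ((L : ℝ) ^ (-t)) ^ i.k := by
  have hL0 : (0 : ℝ) < L := by exact_mod_cast (show 0 < L by omega)
  have hη : (kingGeo L i.k (kingU d L i.e) i.Msz).eta ≠ 0 := by
    show (((L : ℝ) ^ i.k))⁻¹ ≠ 0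
    positivity
  show rateFactor (opGeo (kingGeo L i.k (kingU d L i.e) i.Msz) (Tor (kingU d L i.e)) (fun x => x)) t y = _
  rw [rateFactor_opGeo _ _ _ hη (by exact hL0), T4EtaRateDefect.rateWeight]
  show ((L : ℝ) ^ i.k) ^ (-t) = ((L : ℝ) ^ (-t)) ^ i.k
  exact (Real.rpow_pow_comm hL0.le _ _).symm

/-- Bookkeeping: the [B9] site inequality for the dressed derivative sup entry from the windowed bound (unit lengths, equal rate factors at
exponent `γ∕2`). [cite: Balaban1985BackgroundPropagators, (3.133) p.422 + Thm 3.14 pp.426–427 (shape)] -/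
theorem etaRateIneqSite_dkingHV_of_le (hL : 2 ≤ L) (a m2 s : ℝ) {γ : ℝ} (i : KingPotIdx d)
    (v : ∀ N : ℕ, Tor (fine N (kingU d L i.e)) → ℝ) {C δ : ℝ} (H : ∀ y b : Tor (kingU d L i.e),
      (dkingHSiteV L a m2 s i).ker v y b ≤ C * Real.exp (-(δ * tdistT (kingU d L i.e) y b)) * (((L : ℝ) ^ (-(γ / 2))) ^ i.k))
    (d' : ℕ) (p : ℝ) : EtaRateIneqSite d' p (dkingHSiteV L a m2 s i) C δ (γ / 2) v := by
  intro y b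
  rw [kingInstanceV_len, kingInstanceV_len, kingInstanceV_rateFactor_rpow L hL, kingInstanceV_rateFactor_rpow L hL, max_self,
    Real.one_rpow, Real.one_rpow, mul_one, mul_one, abs_of_nonneg (dkingHSiteV_nonneg L a m2 s i v y b)]
  exact H y b

end Kernel

/-! ## §2 The site inequality on the part-8c family under BOTH letters; the trivial tower -/

section SiteV

variable (L : ℕ) [NeZero L]

/-- **THE TYPED SITE INEQUALITY FOR THE DRESSED DERIVATIVE ENTRY WITH THE POTENTIAL LIVE, UNDER (3.35) ∧ (3.36)** (odd `L ≥ 3`,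
`a, m² > 0`, `c₃₅ > 0`, `0 ≤ γ < 1`, coherence rate `0 ≤ s ≤ L^{−1∕2}`): there are `a₀, C, δ > 0` such that for EVERY index `i`, every `α₀ > 0`
with `Msz·α₀ ≤ a₀` and every potential tower `v` that is (3.35)-regular (size `≤ c₃₅α₀`) AND (3.36)-regular (coherence defect `≤ c₃₅α₀s^k`),
`EtaRateIneqSite d′ p (dkingHSiteV i) C δ (γ∕2) v` for every exponent pair `(d′, p)`. [cite: Balaban1985BackgroundPropagators, (3.35)–(3.36) p.396 + (3.133) p.422 + Thm 3.14 pp.426–427 (template); King1986, Prop. 3.8 (3.71) p.664 (second line, A = 0 model)] -/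
theorem etaRateIneqSite_dkingHV (hLodd : Odd L) (hL : 2 ≤ L) {a m2 : ℝ} (ha : 0 < a) (hm : 0 < m2) {c35 : ℝ} (hc : 0 < c35)
    {γ : ℝ} (hγ0 : 0 ≤ γ) (hγ1 : γ < 1) {s : ℝ} (hs0 : 0 ≤ s) (hs1 : s ≤ (L : ℝ) ^ (-(1 / 2 : ℝ))) :
    ∃ a₀ C δ : ℝ, 0 < a₀ ∧ 0 < C ∧ 0 < δ ∧ ∀ (i : KingPotIdx d) (α₀ : ℝ), 0 < α₀ → i.Msz * α₀ ≤ a₀ →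
      ∀ v : (kingInstanceV (d := d) L s i).Bf.Cfg, (kingInstanceV (d := d) L s i).Bf.Reg335 c35 α₀ v →
        (kingInstanceV (d := d) L s i).Bf.Reg336 c35 α₀ v →
        ∀ (d' : ℕ) (p : ℝ), EtaRateIneqSite d' p (dkingHSiteV L a m2 s i) C δ (γ / 2) v := by
  obtain ⟨wb, C, δ, hwb, hC, hδ, H⟩ := dkingHSiteV_le (d := d) L hLodd hL ha hm hγ0 hγ1
  refine ⟨wb / c35, C, δ, by positivity, hC, hδ, fun i α₀ hα hMa v h335 h336 d' p => ?_⟩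
  have hcα : 0 ≤ c35 * α₀ := by positivity
  have hαw : c35 * α₀ ≤ wb := by
    have h1 : α₀ ≤ i.Msz * α₀ := le_mul_of_one_le_left hα.le i.one_le_Msz
    have h2 : α₀ ≤ wb / c35 := h1.trans hMa
    rw [le_div_iff₀ hc] at h2
    linarith
  exact etaRateIneqSite_dkingHV_of_le L hL a m2 s i v (H s hs0 hs1 i v (c35 * α₀) (c35 * α₀) h335 hαw hcα hαw h336) d' p

/-- **`NE2ZeroSite` HOLDS FOR THE DRESSED DERIVATIVE ENTRY ON THE PART-8c FAMILY** (the trivial tower `v ≡ 0`: both letters with defect `0`;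
constants `(M₅, δ, C, γ′) = (1, δ, C, γ∕2)`, `0 < γ < 1`). [cite: King1986, Prop. 3.8 (3.71) p.664 (second line, A = 0 model)] -/
theorem ne2ZeroSite_dkingHV (hLodd : Odd L) (hL : 2 ≤ L) {a m2 : ℝ} (ha : 0 < a) (hm : 0 < m2) {γ : ℝ} (hγ0 : 0 < γ) (hγ1 : γ < 1)
    {s : ℝ} (hs0 : 0 ≤ s) (hs1 : s ≤ (L : ℝ) ^ (-(1 / 2 : ℝ))) (d' : ℕ) (p : ℝ) :
    NE2ZeroSite d' p (kingInstanceV (d := d) L s) (dkingHSiteV L a m2 s) := by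
  obtain ⟨wb, C, δ, hwb, hC, hδ, H⟩ := dkingHSiteV_le (d := d) L hLodd hL ha hm hγ0.le hγ1
  refine ⟨1, δ, C, γ / 2, one_pos, hδ, hC, half_pos hγ0, fun i _ => ?_⟩
  refine etaRateIneqSite_dkingHV_of_le L hL a m2 s i _ (H s hs0 hs1 i _ 0 0 (fun N x => ?_) hwb.le le_rfl hwb.le fun k hk x' => ?_) d' p
  · show |(0 : ℝ)| ≤ 0
    rw [abs_zero]
  · show |(0 : ℝ) - 0| ≤ 0 * s ^ k
    rw [sub_zero, abs_zero, zero_mul]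

end SiteV

/-! ## §3 On the size-and-coherence sort: the `p = 1` layer BY NAME, and all three dressed kernel layers on one family -/

section SortSC

variable (L : ℕ) [NeZero L]

/-- The dressed derivative site kernel on part 15's size-and-coherence family (same entries as `dkingHSiteV`). [cite: Balaban1985BackgroundPropagators, (3.133) p.422 (shape)] -/
def dkingHSiteSC (a m2 s : ℝ) (i : KingPotIdx d) : B9.SiteKernel (kingInstanceSC L s i).gc (kingInstanceSC L s i).Bf :=
  ⟨(dkingHSiteV L a m2 s i).ker⟩

/-- **`NE2PlusSite` IS INHABITED BY THE DRESSED MINIMISER'S `p = 1` (GRADIENT) ENTRY WITH THE POTENTIAL LIVE — BY NAME** on the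
size-and-coherence family (odd `L ≥ 3`, `a, m² > 0`, `c₃₅ > 0`, `0 < γ < 1`, `0 ≤ s ≤ L^{−1∕2}`; every `d′`, `p`): constants
`(M₅, δ, a₀, C, γ′) = (1, δ, a₀, C, γ∕2)`, uniform in the index AND in the (3.35)-regular tower — the `p = 1` twin of part 15's
`ne2PlusSite_kingHSC`.  HONEST SCOPE: module docstring. [cite: Balaban1985BackgroundPropagators, (3.133) p.422 + Thm 3.14 pp.426–427 (quantifier template); King1986, Prop. 3.8 (3.71) p.664 (second line, A = 0 model)] -/
theorem ne2PlusSite_dkingHSC (hLodd : Odd L) (hL : 2 ≤ L) {a m2 : ℝ} (ha : 0 < a) (hm : 0 < m2) {c35 : ℝ} (hc : 0 < c35)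
    {γ : ℝ} (hγ0 : 0 < γ) (hγ1 : γ < 1) {s : ℝ} (hs0 : 0 ≤ s) (hs1 : s ≤ (L : ℝ) ^ (-(1 / 2 : ℝ))) (d' : ℕ) (p : ℝ) :
    NE2PlusSite d' p c35 (kingInstanceSC (d := d) L s) (dkingHSiteSC L a m2 s) := by
  obtain ⟨a₀, C, δ, ha₀, hC, hδ, H⟩ := etaRateIneqSite_dkingHV (d := d) L hLodd hL ha hm hc hγ0.le hγ1 hs0 hs1
  refine ⟨1, δ, a₀, C, γ / 2, one_pos, hδ, ha₀, hC, half_pos hγ0, fun i _ α₀ hα hMa v h335 => ?_⟩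
  intro y b
  exact H i α₀ hα hMa v h335.1 h335.2 d' p y b

/-- **`NE2ZeroSite`** for the dressed derivative entry on the size-and-coherence family. [cite: King1986, Prop. 3.8 (3.71) p.664 (second line, A = 0 model)] -/
theorem ne2ZeroSite_dkingHSC (hLodd : Odd L) (hL : 2 ≤ L) {a m2 : ℝ} (ha : 0 < a) (hm : 0 < m2) {γ : ℝ} (hγ0 : 0 < γ) (hγ1 : γ < 1)
    {s : ℝ} (hs0 : 0 ≤ s) (hs1 : s ≤ (L : ℝ) ^ (-(1 / 2 : ℝ))) (d' : ℕ) (p : ℝ) :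
    NE2ZeroSite d' p (kingInstanceSC (d := d) L s) (dkingHSiteSC L a m2 s) := by
  obtain ⟨M₅, δ, C, γ', hM, hδ, hC, hγ', H⟩ := ne2ZeroSite_dkingHV (d := d) L hLodd hL ha hm hγ0 hγ1 hs0 hs1 d' p
  exact ⟨M₅, δ, C, γ', hM, hδ, hC, hγ', fun i hMi y b => H i hMi y b⟩

/-- **N15's THREE BACKGROUND-DEPENDENT KERNEL LAYERS OF THE DRESSED KING MINIMISER ∕ COVARIANCE, BY NAME, ON ONE FAMILY WITH THE POTENTIAL
LIVE**: the SITE layer for BOTH (3.133) sup entries of the dressed minimiser's η-difference (`p = 0`: part 15; `p = 1`: the gradient, this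
file) and the UNIT layer for the dressed covariances' η-difference (part 10d), all with uniform constants over the (3.35)∧(3.36)-regular window
of the size-and-coherence sort (odd `L ≥ 3`, `a, m² > 0`, `c₃₅ > 0`, `0 < γ < 1`, `0 ≤ s ≤ L^{−1∕2}`).  HONEST SCOPE: King's A = 0 scalar model
on King-admissible tori with scalar potentials; not Bałaban's covariant objects; count-neutral. [cite: Balaban1985BackgroundPropagators, (3.133) p.422 + Thm 3.14 pp.426–427 + Thm 3.15 p.432 (templates); King1986, Prop. 3.8 (3.71) p.664 (both lines) + Lemma 4.5 (4.38) p.674 (A = 0 model)] -/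
theorem n15_dressedSiteGradUnit_kingSC (hLodd : Odd L) (hL : 2 ≤ L) {a m2 : ℝ} (ha : 0 < a) (hm : 0 < m2) {c35 : ℝ} (hc : 0 < c35)
    {γ : ℝ} (hγ0 : 0 < γ) (hγ1 : γ < 1) {s : ℝ} (hs0 : 0 ≤ s) (hs1 : s ≤ (L : ℝ) ^ (-(1 / 2 : ℝ))) (d' : ℕ) (p₀ p₁ : ℝ) :
    NE2PlusSite d' p₀ c35 (kingInstanceSC (d := d) L s) (kingHSiteSC L a m2 s)
      ∧ NE2PlusSite d' p₁ c35 (kingInstanceSC (d := d) L s) (dkingHSiteSC L a m2 s)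
      ∧ NE2PlusUnit c35 (kingInstanceSC (d := d) L s) (kingKerSC L a m2 s) (fun _ _ => True) (kingDistSC L s) :=
  ⟨ne2PlusSite_kingHSC L hLodd hL ha hm hc hs0 hs1 d' p₀, ne2PlusSite_dkingHSC L hLodd hL ha hm hc hγ0 hγ1 hs0 hs1 d' p₁,
    ne2PlusUnit_kingSC L hLodd hL ha hm hc hs0 hs1⟩

end SortSC

/-! ## §4 The node's K4 face `N15At` with the GRADIENT entry in the site slot -/

section Node

/-- **THE DRESSED KING CARRIERS OF NODE N15, GRADIENT SITE SLOT** (`YMDAG.UVSplit.NE2Carriers`): part 16's `kingCarriersSC` (index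
`KingPotIdx d × Fin (d+1)`, the dressed family with the size-and-coherence POTENTIAL SORT LIVE, operator slot = the dressed covariances'
η-difference entries, unit slot = the dressed covariances' η-difference, `inΛ := True`, `unitDist := tdistT`) with the SITE slot now the
`p = 1` (3.133) sup entry of the dressed minimiser's GRADIENT (`dkingHSiteSC`); `c₃₅`, `p` free.
[cite: King1986, Prop. 3.8 (3.71) p.664 (second line) + Lemma 4.5 (4.38) p.674 (the objects, A = 0); Balaban1985BackgroundPropagators, Thm 3.1 p.397 + (3.133) p.422 + Thm 3.14 pp.426–427 + Thm 3.15 p.432 (shapes)] -/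
def kingCarriersSCGrad (d L : ℕ) [NeZero L] (a m2 s c35 p : ℝ) : NE2Carriers where
  I := KingPotIdx d × Fin (d + 1)
  c35 := c35
  p := p
  pi := kingInstanceSCν (d := d) L s
  Kop := kingOpSC L a m2 s
  Ksite := fun j => dkingHSiteSC L a m2 s j.1
  Kunit := fun j => kingKerSC L a m2 s j.1
  inΛ := fun _ _ => True
  unitDist := fun j => kingDistSC L s j.1

/-- **`N15At` ON THE DRESSED KING CARRIERS WITH THE GRADIENT ENTRY IN THE SITE SLOT** (every torus dimension `d + 1`, odd `L ≥ 3`,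
`a, m² > 0`, `c₃₅ > 0`, `0 ≤ s ≤ L^{−1∕2}`, every `p`): `NE2PlusOperator c₃₅ _ (dressed 𝔇(C^{(k+1)}_v, C^{(k)}_v) entries, part 16) ∧
NE2PlusSite 4 p c₃₅ _ (the dressed minimiser's GRADIENT sup entries, rate exponent `1∕4` = `γ∕2` at `γ = 1∕2`, this file) ∧ NE2PlusUnit c₃₅ _
(dressed covariances, part 15 ∕ 10d) True tdistT`, each with constants UNIFORM over the index block AND over the (3.35)-regular potential towers
of the window.  NOT Bałaban's carriers of record (NODE 00: gauge fields, covariant operators); NOT a node discharge; count-neutral.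
[cite: King1986, Prop. 3.8 (3.71) p.664 (second line) + Lemma 4.5 (4.38) p.674 (A = 0 model); Balaban1985BackgroundPropagators, Thm 3.1 p.397 + Thm 3.14 pp.426–427 + Thm 3.15 (3.187) p.432 (quantifier templates)] -/
theorem n15At_kingModelSCGrad (d : ℕ) {L : ℕ} [NeZero L] (hLodd : Odd L) (hL : 2 ≤ L) {a m2 : ℝ} (ha : 0 < a) (hm : 0 < m2)
    {c35 : ℝ} (hc : 0 < c35) {s : ℝ} (hs0 : 0 ≤ s) (hs1 : s ≤ (L : ℝ) ^ (-(1 / 2 : ℝ))) (p : ℝ) :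
    N15At (kingCarriersSCGrad d L a m2 s c35 p) := by
  refine ⟨ne2PlusOperator_kingSC L hLodd hL ha hm hc hs0 hs1, ?_, ?_⟩
  · obtain ⟨M₅, δ, a₀, C, γ, hM, hδ, ha₀, hC, hγ, H⟩ :=
      ne2PlusSite_dkingHSC (d := d) L hLodd hL ha hm hc (γ := 1 / 2) (by norm_num) (by norm_num) hs0 hs1 4 p
    exact ⟨M₅, δ, a₀, C, γ, hM, hδ, ha₀, hC, hγ, fun j => H j.1⟩
  · obtain ⟨δ₀, a₀, B₀, θ, hδ, ha₀, hB, hθ0, hθ1, H⟩ := ne2PlusUnit_kingSC (d := d) L hLodd hL ha hm hc hs0 hs1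
    exact ⟨δ₀, a₀, B₀, θ, hδ, ha₀, hB, hθ0, hθ1, fun j => H j.1⟩

/-- **THE FOUR-TORUS INSTANCE** (`d + 1 = 4`). [cite: King1986, Prop. 3.8 (3.71) p.664 (second line, A = 0 model)] -/
theorem n15At_kingModelSCGrad_dim4 {L : ℕ} [NeZero L] (hLodd : Odd L) (hL : 2 ≤ L) {a m2 : ℝ} (ha : 0 < a) (hm : 0 < m2)
    {c35 : ℝ} (hc : 0 < c35) {s : ℝ} (hs0 : 0 ≤ s) (hs1 : s ≤ (L : ℝ) ^ (-(1 / 2 : ℝ))) (p : ℝ) :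
    N15At (kingCarriersSCGrad 3 L a m2 s c35 p) :=
  n15At_kingModelSCGrad 3 hLodd hL ha hm hc hs0 hs1 p

/-- NON-VACUITY OF THE INDEX BLOCK of the gradient-slot carriers. [folklore] -/
theorem kingCarriersSCGrad_index_nonempty (d L : ℕ) [NeZero L] (a m2 s c35 p : ℝ) :
    Nonempty (kingCarriersSCGrad d L a m2 s c35 p).I :=
  ⟨(⟨0, 1, le_rfl, 1, le_rfl, 1, le_rfl⟩, 0)⟩

/-- NON-VACUITY OF THE BACKGROUND WINDOW of the gradient-slot carriers: the block lift of every unit-lattice field of sup `≤ c₃₅α₀` is in the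
(3.35)-window at every index (`s ≥ 0`). [folklore] -/
theorem kingCarriersSCGrad_window_populated {L : ℕ} [NeZero L] (a m2 : ℝ) {s : ℝ} (hs : 0 ≤ s) (c35 p : ℝ)
    (j : KingPotIdx d × Fin (d + 1)) (α₀ : ℝ) (W : Tor (kingU d L j.1.e) → ℝ) (hW : ∀ z, |W z| ≤ c35 * α₀) :
    ((kingCarriersSCGrad d L a m2 s c35 p).pi j).Bf.Reg335 c35 α₀ (blockLift (kingU d L j.1.e) W) :=
  (potBgSC_reg_blockLift (d := d) L hs (kingU d L j.1.e) W hW).1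

end Node

end Summit.QuantumFields.YangMills.BalabanUVNodes.N15.KingModel

end
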